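import Mathlib
import HarnessLib
import Summits.NavierStokesRegularity.NavierStokesRegularity.Theorems.PoloidalWindowDoorLrcModEntireCurvedTimeWebAt

/-!
# Route `PoloidalWindowDoor`, item `LrcModEntire` (stmt-NavierStokesRegularity-20428), cell (Q4-curved) of the (TH) column —
# B-TWP0c C5: THE RIDGE HEIGHT `R(τ,z)` IS REAL-ANALYTIC OVER A CURVED BRANCH (the `hRan` of the tower window at base time `0`)

Cell ns-regularity-ideate, stub-worker seat ns-poloidal-K2-p2 g18 under the LEAD of item 20428 (ns-poloidal-K2-p3 g17/g18);
`--supports stmt-NavierStokesRegularity-20428 --as helper`.  The line-frame tools `…WebPackageAnalytic.ridgeHeight_analyticAt` /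
`…PeriodicSheetAtTime.ridgeHeight_analyticOnNhd_height` want the (Q4) package along the cross-sections `s·e + n·Je + z·e₂` for EVERY line parameter `s`; a
CURVED hot branch `Γ` only supplies it along its own normals.  But the ridge height only needs ONE base point: with the 2-parameter cross-section family
`f((τ,z),n) := σ·U₂(−1+τ, Γ 0 + n·JΓ′(0) + z·e₂)` (real-analytic: `…Ancient.analyticOnNhd_uncurry`, affine inside), the web function `m(τ,z) := n₀(τ,0,z)` of this
seat's `…CurvedTimeWebFunction.exists_curvedTimeWebFunction` is critical along the fibres of a strictly concave analytic family, hence real-analytic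
(this seat's g16 `…CurvedWebTools.contDiffAt_criticalPoint_of_contDiffAt` at `ω`), and `R(τ,z) = f((τ,z), m(τ,z))`.

* `baseSection_analyticAt`, `fderiv_baseSection_fibre`, `fderiv_fderiv_baseSection_fibre` — the family `f` over a base point `c` with unit normal `ν`: analytic for
  `τ < 1`, fibre derivatives `= ∂_ν F_τ`, `D²F_τ[ν,ν]` at `c + n·ν + z·e₂`;
* ★ `ridgeHeight_analyticAt_curved` — hypotheses in the currency of `…CurvedTimeWebAt.curved_time_web_package` (Γ `C^∞`, `νΓ`, concavity and the web Fermat law on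
  the `δ`-box, `δ ≤ 1/2`) ⊢ `AnalyticAt ℝ (uncurry R) (τ, z)` for `|τ|, |z| < δ`;
* ★ `ridgeHeight_analyticOnNhd_height_curved` — hence `AnalyticOnNhd ℝ (R τ) (Ioo (−δ) δ)` for `|τ| < δ` (input `hg` of `…CurvedWebWindowSelect.exists_tower_window` /
  port-2 g9's `exists_noncharacteristic_subwindow` at base time `0` of the v16 non-vertical child), and `ridgeHeight_analyticAt_time_curved` (the `τ`-direction).

WHAT THIS IS NOT: not a claim about Navier–Stokes regularity; closes nothing; items 20428 / 19708 / 27893 OPEN (bears_on LADDER-NS N0).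
-/

noncomputable section

set_option linter.dupNamespace false
set_option linter.style.longLine false

namespace Summit.NavierStokesRegularity.NavierStokesRegularity.Theorems.PoloidalWindowDoorLrcModEntireCurvedRidgeAnalytic

open Set Function Filter Topology Metric
open scoped RealInnerProductSpace InnerProductSpace ContDiff
open Literature.Analysis Literature.Analysis.FluidPDE Literature.Analysis.UnboundedOperators
open Summit.NavierStokesRegularity.NavierStokesRegularity.Theorems
open Summit.NavierStokesRegularity.NavierStokesRegularity.Theorems.LocalSineTubeDoorProfileAlignedWindowRigidityAncient
open Summit.NavierStokesRegularity.NavierStokesRegularity.Theorems.PoloidalWindowDoorLrcModEntireSheetFlattenTools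
open Summit.NavierStokesRegularity.NavierStokesRegularity.Theorems.PoloidalWindowDoorLrcModEntireRidgeGlobalBranchFrame
open Summit.NavierStokesRegularity.NavierStokesRegularity.Theorems.PoloidalWindowDoorLrcModEntireRidgeWebImplicit
open Summit.NavierStokesRegularity.NavierStokesRegularity.Theorems.PoloidalWindowDoorLrcModEntireRidgeClassConstants
open Summit.NavierStokesRegularity.NavierStokesRegularity.Theorems.PoloidalWindowDoorLrcModEntireCurvedWebTools
open Summit.NavierStokesRegularity.NavierStokesRegularity.Theorems.PoloidalWindowDoorLrcModEntireQ4TimeWebFunction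
open Summit.NavierStokesRegularity.NavierStokesRegularity.Theorems.PoloidalWindowDoorLrcModEntireCurvedTimeWebFunction

variable {C : ℝ} {U : ℝ → EuclideanSpace ℝ (Fin 3) → EuclideanSpace ℝ (Fin 3)}

/-- **The base cross-section family is real-analytic**: `((τ,z),n) ↦ σ·U₂(−1+τ, c + n·ν + z·e₂)` at every point with `τ < 1` (class: `uncurry U` is real-analytic on
`t < 0`; the inner map is affine). -/
theorem baseSection_analyticAt (hUrate : HasTypeITimeDecay C U) (hUcont : ContinuousOn (uncurry U) (Iio (0 : ℝ) ×ˢ univ))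
    (hUmild : ∀ s t : ℝ, s < t → t < 0 → ∀ x, U t x = heatExtension (U s) (t - s) x - oseenDuhamel 1 s U U t x)
    (σ : ℝ) (c ν : EuclideanSpace ℝ (Fin 3)) {w : ℝ × ℝ} (hw : w.1 < 1) (n : ℝ) :
    AnalyticAt ℝ (fun v : (ℝ × ℝ) × ℝ => σ * U (-1 + v.1.1) (c + v.2 • ν + v.1.2 • e2) 2) (w, n) := by
  have h11 : AnalyticAt ℝ (fun v : (ℝ × ℝ) × ℝ => v.1.1) (w, n) :=
    AnalyticAt.comp (g := fun p : ℝ × ℝ => p.1) (f := fun v : (ℝ × ℝ) × ℝ => v.1) analyticAt_fst analyticAt_fst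
  have h12 : AnalyticAt ℝ (fun v : (ℝ × ℝ) × ℝ => v.1.2) (w, n) :=
    AnalyticAt.comp (g := fun p : ℝ × ℝ => p.2) (f := fun v : (ℝ × ℝ) × ℝ => v.1) analyticAt_snd analyticAt_fst
  have hB : AnalyticAt ℝ (fun v : (ℝ × ℝ) × ℝ => ((-1 + v.1.1, c + v.2 • ν + v.1.2 • e2) : ℝ × EuclideanSpace ℝ (Fin 3))) (w, n) :=
    (analyticAt_const.add h11).prod ((analyticAt_const.add (analyticAt_snd.smul analyticAt_const)).add (h12.smul analyticAt_const))
  have hUan : AnalyticAt ℝ (uncurry U) ((-1 + w.1, c + n • ν + w.2 • e2) : ℝ × EuclideanSpace ℝ (Fin 3)) :=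
    analyticOnNhd_uncurry hUcont (bdd_of_hasTypeITimeDecay hUrate) hUmild _ (mem_prod.2 ⟨by show -1 + w.1 < 0; linarith, mem_univ _⟩)
  have hcomp : AnalyticAt ℝ (fun v : (ℝ × ℝ) × ℝ => uncurry U ((-1 + v.1.1, c + v.2 • ν + v.1.2 • e2) : ℝ × EuclideanSpace ℝ (Fin 3))) (w, n) :=
    hUan.comp_of_eq hB rfl
  have h2 : AnalyticAt ℝ (fun v : (ℝ × ℝ) × ℝ => (uncurry U ((-1 + v.1.1, c + v.2 • ν + v.1.2 • e2) : ℝ × EuclideanSpace ℝ (Fin 3))) 2) (w, n) :=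
    ((EuclideanSpace.proj (𝕜 := ℝ) (2 : Fin 3)).analyticAt _).comp hcomp
  exact analyticAt_const.mul h2

/-- **First fibre derivative** of the base family: `∂_n f((τ,z),n) = ∂_ν(σ·U₂(−1+τ,·))(c + n·ν + z·e₂)`. -/
theorem fderiv_baseSection_fibre (hUrate : HasTypeITimeDecay C U) (hUcont : ContinuousOn (uncurry U) (Iio (0 : ℝ) ×ˢ univ))
    (hUmild : ∀ s t : ℝ, s < t → t < 0 → ∀ x, U t x = heatExtension (U s) (t - s) x - oseenDuhamel 1 s U U t x)
    (hUdiv : ∀ t < 0, VectorCalculus.IsDivFree (U t))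
    (σ : ℝ) (c ν : EuclideanSpace ℝ (Fin 3)) {w : ℝ × ℝ} (hw : w.1 < 1) (n : ℝ) :
    fderiv ℝ (fun v : (ℝ × ℝ) × ℝ => σ * U (-1 + v.1.1) (c + v.2 • ν + v.1.2 • e2) 2) (w, n) ((0 : ℝ × ℝ), (1 : ℝ)) =
      fderiv ℝ (fun y => σ * U (-1 + w.1) y 2) (c + n • ν + w.2 • e2) ν := by
  have ht : -1 + w.1 < 0 := by linarith
  have hGd : DifferentiableAt ℝ (fun v : (ℝ × ℝ) × ℝ => σ * U (-1 + v.1.1) (c + v.2 • ν + v.1.2 • e2) 2) (w, n) :=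
    (baseSection_analyticAt hUrate hUcont hUmild σ c ν hw n).differentiableAt
  have hι : HasDerivAt (fun m : ℝ => ((w, m) : (ℝ × ℝ) × ℝ)) ((0 : ℝ × ℝ), (1 : ℝ)) n :=
    (hasDerivAt_const n w).prodMk (hasDerivAt_id n)
  have h1 := hGd.hasFDerivAt.comp_hasDerivAt n hι
  have hFτ : ContDiff ℝ 2 (fun y => σ * U (-1 + w.1) y 2) := contDiff_signed_slice hUrate hUcont hUmild hUdiv ht σ
  have hl : HasDerivAt (fun m : ℝ => c + m • ν + w.2 • e2) ν n := by
    have h := (((hasDerivAt_id n).smul_const ν).const_add c).add_const (w.2 • e2)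
    simpa using h
  have h2 : HasDerivAt (fun m : ℝ => σ * U (-1 + w.1) (c + m • ν + w.2 • e2) 2)
      (fderiv ℝ (fun y => σ * U (-1 + w.1) y 2) (c + n • ν + w.2 • e2) ν) n :=
    ((hFτ.differentiable (by norm_num)) _).hasFDerivAt.comp_hasDerivAt n hl
  exact h1.unique h2

/-- **Second fibre derivative** of the base family: `∂²_n f((τ,z),n) = D²(σ·U₂(−1+τ,·))(c + n·ν + z·e₂)[ν,ν]`. -/
theorem fderiv_fderiv_baseSection_fibre (hUrate : HasTypeITimeDecay C U) (hUcont : ContinuousOn (uncurry U) (Iio (0 : ℝ) ×ˢ univ))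
    (hUmild : ∀ s t : ℝ, s < t → t < 0 → ∀ x, U t x = heatExtension (U s) (t - s) x - oseenDuhamel 1 s U U t x)
    (hUdiv : ∀ t < 0, VectorCalculus.IsDivFree (U t))
    (σ : ℝ) (c ν : EuclideanSpace ℝ (Fin 3)) {w : ℝ × ℝ} (hw : w.1 < 1) (n : ℝ) :
    fderiv ℝ (fderiv ℝ (fun v : (ℝ × ℝ) × ℝ => σ * U (-1 + v.1.1) (c + v.2 • ν + v.1.2 • e2) 2)) (w, n)
        ((0 : ℝ × ℝ), (1 : ℝ)) ((0 : ℝ × ℝ), (1 : ℝ)) =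
      fderiv ℝ (fderiv ℝ (fun y => σ * U (-1 + w.1) y 2)) (c + n • ν + w.2 • e2) ν ν := by
  have ht : -1 + w.1 < 0 := by linarith
  have hG2 : ContDiffAt ℝ 2 (fun v : (ℝ × ℝ) × ℝ => σ * U (-1 + v.1.1) (c + v.2 • ν + v.1.2 • e2) 2) (w, n) :=
    (baseSection_analyticAt hUrate hUcont hUmild σ c ν hw n).contDiffAt
  have hGd2 : DifferentiableAt ℝ (fderiv ℝ (fun v : (ℝ × ℝ) × ℝ => σ * U (-1 + v.1.1) (c + v.2 • ν + v.1.2 • e2) 2)) (w, n) :=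
    (hG2.fderiv_right (m := 1) le_rfl).differentiableAt (by simp)
  have h1 := hasDerivAt_partial_fibre hGd2
  have hEq : (fun m : ℝ => fderiv ℝ (fun v : (ℝ × ℝ) × ℝ => σ * U (-1 + v.1.1) (c + v.2 • ν + v.1.2 • e2) 2) (w, m) ((0 : ℝ × ℝ), (1 : ℝ))) =
      fun m : ℝ => fderiv ℝ (fun y => σ * U (-1 + w.1) y 2) (c + m • ν + w.2 • e2) ν :=
    funext fun m => fderiv_baseSection_fibre hUrate hUcont hUmild hUdiv σ c ν hw m
  rw [hEq] at h1
  have hFτ : ContDiff ℝ 2 (fun y => σ * U (-1 + w.1) y 2) := contDiff_signed_slice hUrate hUcont hUmild hUdiv ht σ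
  have hDF : ∀ y, HasFDerivAt (fderiv ℝ (fun y => σ * U (-1 + w.1) y 2)) (fderiv ℝ (fderiv ℝ (fun y => σ * U (-1 + w.1) y 2)) y) y := fun y =>
    (((hFτ.fderiv_right (m := 1) (by norm_num)).differentiable one_ne_zero) y).hasFDerivAt
  have hline : HasDerivAt (fun m : ℝ => c + m • ν + w.2 • e2) ν n := by
    have h := (((hasDerivAt_id n).smul_const ν).const_add c).add_const (w.2 • e2)
    simpa using h
  have h2 : HasDerivAt (fun m : ℝ => fderiv ℝ (fun y => σ * U (-1 + w.1) y 2) (c + m • ν + w.2 • e2) ν)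
      (fderiv ℝ (fderiv ℝ (fun y => σ * U (-1 + w.1) y 2)) (c + n • ν + w.2 • e2) ν ν) n := by
    have hc : HasDerivAt (fun m : ℝ => fderiv ℝ (fun y => σ * U (-1 + w.1) y 2) (c + m • ν + w.2 • e2))
        (fderiv ℝ (fderiv ℝ (fun y => σ * U (-1 + w.1) y 2)) (c + n • ν + w.2 • e2) ν) n := (hDF _).comp_hasDerivAt n hline
    exact hc.clm_apply (hasDerivAt_const n ν) |>.congr_deriv (by simp)
  exact h1.unique h2

/-- ★ **THE RIDGE HEIGHT IS JOINTLY REAL-ANALYTIC over a curved branch.**  Hypotheses in the currency of `…CurvedTimeWebAt.curved_time_web_package`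
(`Γ ∈ C^∞`, `νΓ = JΓ′`, strict concavity of the Fermi cross-sections and the web Fermat law on the `δ`-box, `δ ≤ 1/2`): `AnalyticAt ℝ (uncurry R) (τ, z)` for
`|τ|, |z| < δ`. -/
theorem ridgeHeight_analyticAt_curved (hUrate : HasTypeITimeDecay C U) (hUcont : ContinuousOn (uncurry U) (Iio (0 : ℝ) ×ˢ univ))
    (hUmild : ∀ s t : ℝ, s < t → t < 0 → ∀ x, U t x = heatExtension (U s) (t - s) x - oseenDuhamel 1 s U U t x)
    (hUdiv : ∀ t < 0, VectorCalculus.IsDivFree (U t))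
    {σ : ℝ} {Γ νΓ : ℝ → EuclideanSpace ℝ (Fin 3)} {r δ : ℝ} {R : ℝ → ℝ → ℝ}
    (hΓ : ContDiff ℝ ∞ Γ) (hν : ∀ s, νΓ s = WithLp.toLp 2 ![-(deriv Γ s 1), deriv Γ s 0, 0]) (hδh : δ ≤ 1 / 2)
    (hconc : ∀ τ z : ℝ, |τ| < δ → |z| < δ → ∀ s : ℝ, ∀ n ∈ Ioo (-r) r,
      fderiv ℝ (fderiv ℝ (fun y => σ * U (-1 + τ) y 2)) (Γ s + n • νΓ s + z • EuclideanSpace.single 2 (1 : ℝ)) (νΓ s) (νΓ s) < 0)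
    (hweb : ∀ τ₀ z₀ : ℝ, |τ₀| < δ → |z₀| < δ → ∀ s₀ : ℝ, ∃ n₀ ∈ Ioo (-r) r,
      σ * U (-1 + τ₀) (Γ s₀ + n₀ • νΓ s₀ + z₀ • EuclideanSpace.single 2 (1 : ℝ)) 2 = R τ₀ z₀ ∧
      (∀ n ∈ Icc (-r) r, n ≠ n₀ → σ * U (-1 + τ₀) (Γ s₀ + n • νΓ s₀ + z₀ • EuclideanSpace.single 2 (1 : ℝ)) 2 < R τ₀ z₀) ∧
      DifferentiableAt ℝ (uncurry R) (τ₀, z₀) ∧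
      fderiv ℝ (uncurry fun τ y => σ * U (-1 + τ) y 2) (τ₀, Γ s₀ + n₀ • νΓ s₀ + z₀ • EuclideanSpace.single 2 (1 : ℝ)) =
        (fderiv ℝ (uncurry R) (τ₀, z₀)).comp
          ((ContinuousLinearMap.fst ℝ ℝ (EuclideanSpace ℝ (Fin 3))).prod
            ((EuclideanSpace.proj (2 : Fin 3)).comp (ContinuousLinearMap.snd ℝ ℝ (EuclideanSpace ℝ (Fin 3))))))
    {τ z : ℝ} (hτ : |τ| < δ) (hz : |z| < δ) : AnalyticAt ℝ (uncurry R) (τ, z) := by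
  have hνJ : ∀ s, νΓ s = rotJ (deriv Γ s) := fun s => by rw [hν s]; rfl
  have hpt : ∀ s n z : ℝ, Γ s + n • νΓ s + z • EuclideanSpace.single 2 (1 : ℝ) = Γ s + n • rotJ (deriv Γ s) + z • e2 := fun s n z => by
    rw [hνJ s]; rfl
  /- the space–time web function over `Γ` on the `δ`-box -/
  set T : Set ℝ := Ioo (-1 / 2 : ℝ) (1 / 2) with hT_def
  have hTo : IsOpen T := isOpen_Ioo
  obtain ⟨F, hF_def⟩ : ∃ F : ℝ → EuclideanSpace ℝ (Fin 3) → ℝ, F = fun τ y => σ * U (-1 + τ) y 2 := ⟨_, rfl⟩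
  have hFst : IsSmoothSpaceTimeOn T F := by
    have h := contDiffOn_uncurry_signed hUrate hUcont hUmild hUdiv σ (n := ⊤) (T := T) Subset.rfl
    rw [hF_def]; exact h
  have hδT : Ioo (-δ) δ ⊆ T := fun τ hτ => ⟨by linarith [hτ.1], by linarith [hτ.2]⟩
  have hconcF : ∀ τ z : ℝ, |τ| < δ → |z| < δ → ∀ s : ℝ, ∀ n ∈ Ioo (-r) r,
      fderiv ℝ (fderiv ℝ (F τ)) (Γ s + n • rotJ (deriv Γ s) + z • e2) (rotJ (deriv Γ s)) (rotJ (deriv Γ s)) < 0 := by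
    intro τ z hτ hz s n hn
    have h := hconc τ z hτ hz s n hn
    rw [hpt, hνJ] at h
    rw [hF_def]; exact h
  have hS : ∀ τ z : ℝ, |τ| < δ → |z| < δ → ∀ s : ℝ, ∃ n₁ ∈ Ioo (-r) r, F τ (Γ s + n₁ • rotJ (deriv Γ s) + z • e2) = R τ z ∧
      ∀ n ∈ Icc (-r) r, n ≠ n₁ → F τ (Γ s + n • rotJ (deriv Γ s) + z • e2) < R τ z := by
    intro τ z hτ hz s
    obtain ⟨n₁, hn₁, hval, huniq, -, -⟩ := hweb τ z hτ hz s
    refine ⟨n₁, hn₁, ?_, fun n hn hne => ?_⟩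
    · rw [hF_def, ← hpt]; exact hval
    · rw [hF_def, ← hpt]; exact huniq n hn hne
  obtain ⟨n₀, hspec, hcrit, -⟩ := exists_curvedTimeWebFunction hTo hFst hΓ hδT hconcF hS
  /- the 2-parameter base family at `s = 0` and its critical-point function -/
  set V : Set (ℝ × ℝ) := {w | |w.1| < δ ∧ |w.2| < δ} with hV
  have hVo : IsOpen V := (isOpen_lt continuous_fst.abs continuous_const).inter (isOpen_lt continuous_snd.abs continuous_const)
  have hw1 : ∀ w ∈ V, w.1 < 1 := fun w hw => by linarith [(abs_lt.1 hw.1).2, hδh]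
  obtain ⟨f, hf⟩ : ∃ f : (ℝ × ℝ) × ℝ → ℝ, f = fun v => σ * U (-1 + v.1.1) (Γ 0 + v.2 • rotJ (deriv Γ 0) + v.1.2 • e2) 2 := ⟨_, rfl⟩
  obtain ⟨m, hm⟩ : ∃ m : ℝ × ℝ → ℝ, m = fun w => n₀ (w.1, (0 : ℝ), w.2) := ⟨_, rfl⟩
  have hG : ∀ p ∈ V, ∀ n' ∈ Ioo (-r) r, ContDiffAt ℝ ω f (p, n') := fun p hp n' _ => by
    rw [hf]; exact (baseSection_analyticAt hUrate hUcont hUmild σ (Γ 0) (rotJ (deriv Γ 0)) (hw1 p hp) n').contDiffAt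
  have hconcG : ∀ p ∈ V, ∀ n' ∈ Ioo (-r) r, fderiv ℝ (fderiv ℝ f) (p, n') ((0 : ℝ × ℝ), (1 : ℝ)) ((0 : ℝ × ℝ), (1 : ℝ)) < 0 := by
    intro p hp n' hn'
    rw [hf, fderiv_fderiv_baseSection_fibre hUrate hUcont hUmild hUdiv σ (Γ 0) (rotJ (deriv Γ 0)) (hw1 p hp) n']
    have h := hconcF p.1 p.2 hp.1 hp.2 0 n' hn'
    rw [hF_def] at h; exact h
  have hn₀V : ∀ p ∈ V, m p ∈ Ioo (-r) r := fun p hp => by rw [hm]; exact (hspec (p.1, (0 : ℝ), p.2) hp.1 hp.2).1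
  have hcritG : ∀ p ∈ V, fderiv ℝ f (p, m p) ((0 : ℝ × ℝ), (1 : ℝ)) = 0 := by
    intro p hp
    rw [hf, hm, fderiv_baseSection_fibre hUrate hUcont hUmild hUdiv σ (Γ 0) (rotJ (deriv Γ 0)) (hw1 p hp)]
    have h := hcrit (p.1, (0 : ℝ), p.2) hp.1 hp.2
    rw [hF_def] at h; exact h
  have hwV : ((τ, z) : ℝ × ℝ) ∈ V := ⟨hτ, hz⟩
  have hmω : AnalyticAt ℝ m (τ, z) :=
    (contDiffAt_criticalPoint_of_contDiffAt hVo (m := ω) (n := ω) (by simp) (by simp) hG hconcG hn₀V hcritG hwV).analyticAt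
  /- `R = f ∘ (id, m)` near `(τ, z)` -/
  have hpair : AnalyticAt ℝ (fun w : ℝ × ℝ => ((w, m w) : (ℝ × ℝ) × ℝ)) (τ, z) := analyticAt_id.prod hmω
  have hfω : AnalyticAt ℝ f (((τ, z) : ℝ × ℝ), m (τ, z)) := by
    rw [hf]; exact baseSection_analyticAt hUrate hUcont hUmild σ (Γ 0) (rotJ (deriv Γ 0)) (hw1 _ hwV) (m (τ, z))
  have hcompR : AnalyticAt ℝ (fun w : ℝ × ℝ => f (w, m w)) (τ, z) := hfω.comp_of_eq hpair rfl
  refine hcompR.congr ?_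
  filter_upwards [hVo.mem_nhds hwV] with w hw
  have h := (hspec (w.1, (0 : ℝ), w.2) hw.1 hw.2).2.1
  rw [hF_def] at h
  rw [hf, hm]
  exact h

/-- ★ **`R(τ,·)` IS REAL-ANALYTIC ON `(−δ, δ)` for `|τ| < δ`** (curved branch) — the `hg`/`hRan` input of the tower window at base time `0`. -/
theorem ridgeHeight_analyticOnNhd_height_curved (hUrate : HasTypeITimeDecay C U) (hUcont : ContinuousOn (uncurry U) (Iio (0 : ℝ) ×ˢ univ))
    (hUmild : ∀ s t : ℝ, s < t → t < 0 → ∀ x, U t x = heatExtension (U s) (t - s) x - oseenDuhamel 1 s U U t x)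
    (hUdiv : ∀ t < 0, VectorCalculus.IsDivFree (U t))
    {σ : ℝ} {Γ νΓ : ℝ → EuclideanSpace ℝ (Fin 3)} {r δ : ℝ} {R : ℝ → ℝ → ℝ}
    (hΓ : ContDiff ℝ ∞ Γ) (hν : ∀ s, νΓ s = WithLp.toLp 2 ![-(deriv Γ s 1), deriv Γ s 0, 0]) (hδh : δ ≤ 1 / 2)
    (hconc : ∀ τ z : ℝ, |τ| < δ → |z| < δ → ∀ s : ℝ, ∀ n ∈ Ioo (-r) r,
      fderiv ℝ (fderiv ℝ (fun y => σ * U (-1 + τ) y 2)) (Γ s + n • νΓ s + z • EuclideanSpace.single 2 (1 : ℝ)) (νΓ s) (νΓ s) < 0)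
    (hweb : ∀ τ₀ z₀ : ℝ, |τ₀| < δ → |z₀| < δ → ∀ s₀ : ℝ, ∃ n₀ ∈ Ioo (-r) r,
      σ * U (-1 + τ₀) (Γ s₀ + n₀ • νΓ s₀ + z₀ • EuclideanSpace.single 2 (1 : ℝ)) 2 = R τ₀ z₀ ∧
      (∀ n ∈ Icc (-r) r, n ≠ n₀ → σ * U (-1 + τ₀) (Γ s₀ + n • νΓ s₀ + z₀ • EuclideanSpace.single 2 (1 : ℝ)) 2 < R τ₀ z₀) ∧
      DifferentiableAt ℝ (uncurry R) (τ₀, z₀) ∧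
      fderiv ℝ (uncurry fun τ y => σ * U (-1 + τ) y 2) (τ₀, Γ s₀ + n₀ • νΓ s₀ + z₀ • EuclideanSpace.single 2 (1 : ℝ)) =
        (fderiv ℝ (uncurry R) (τ₀, z₀)).comp
          ((ContinuousLinearMap.fst ℝ ℝ (EuclideanSpace ℝ (Fin 3))).prod
            ((EuclideanSpace.proj (2 : Fin 3)).comp (ContinuousLinearMap.snd ℝ ℝ (EuclideanSpace ℝ (Fin 3))))))
    {τ : ℝ} (hτ : |τ| < δ) : AnalyticOnNhd ℝ (R τ) (Ioo (-δ) δ) := by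
  intro z hz
  have hz' : |z| < δ := abs_lt.2 ⟨hz.1, hz.2⟩
  have h := ridgeHeight_analyticAt_curved hUrate hUcont hUmild hUdiv hΓ hν hδh hconc hweb hτ hz'
  have hline : AnalyticAt ℝ (fun z' : ℝ => ((τ, z') : ℝ × ℝ)) z := analyticAt_const.prod analyticAt_id
  exact h.comp_of_eq hline rfl

/-- **`τ ↦ R(τ,z)` is real-analytic on `|τ| < δ` for `|z| < δ`** (curved branch) — the `hRan` input of port-2's `…WebPackageAnalytic.eventually_nonsonic`. -/
theorem ridgeHeight_analyticAt_time_curved (hUrate : HasTypeITimeDecay C U) (hUcont : ContinuousOn (uncurry U) (Iio (0 : ℝ) ×ˢ univ))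
    (hUmild : ∀ s t : ℝ, s < t → t < 0 → ∀ x, U t x = heatExtension (U s) (t - s) x - oseenDuhamel 1 s U U t x)
    (hUdiv : ∀ t < 0, VectorCalculus.IsDivFree (U t))
    {σ : ℝ} {Γ νΓ : ℝ → EuclideanSpace ℝ (Fin 3)} {r δ : ℝ} {R : ℝ → ℝ → ℝ}
    (hΓ : ContDiff ℝ ∞ Γ) (hν : ∀ s, νΓ s = WithLp.toLp 2 ![-(deriv Γ s 1), deriv Γ s 0, 0]) (hδh : δ ≤ 1 / 2)
    (hconc : ∀ τ z : ℝ, |τ| < δ → |z| < δ → ∀ s : ℝ, ∀ n ∈ Ioo (-r) r,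
      fderiv ℝ (fderiv ℝ (fun y => σ * U (-1 + τ) y 2)) (Γ s + n • νΓ s + z • EuclideanSpace.single 2 (1 : ℝ)) (νΓ s) (νΓ s) < 0)
    (hweb : ∀ τ₀ z₀ : ℝ, |τ₀| < δ → |z₀| < δ → ∀ s₀ : ℝ, ∃ n₀ ∈ Ioo (-r) r,
      σ * U (-1 + τ₀) (Γ s₀ + n₀ • νΓ s₀ + z₀ • EuclideanSpace.single 2 (1 : ℝ)) 2 = R τ₀ z₀ ∧
      (∀ n ∈ Icc (-r) r, n ≠ n₀ → σ * U (-1 + τ₀) (Γ s₀ + n • νΓ s₀ + z₀ • EuclideanSpace.single 2 (1 : ℝ)) 2 < R τ₀ z₀) ∧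
      DifferentiableAt ℝ (uncurry R) (τ₀, z₀) ∧
      fderiv ℝ (uncurry fun τ y => σ * U (-1 + τ) y 2) (τ₀, Γ s₀ + n₀ • νΓ s₀ + z₀ • EuclideanSpace.single 2 (1 : ℝ)) =
        (fderiv ℝ (uncurry R) (τ₀, z₀)).comp
          ((ContinuousLinearMap.fst ℝ ℝ (EuclideanSpace ℝ (Fin 3))).prod
            ((EuclideanSpace.proj (2 : Fin 3)).comp (ContinuousLinearMap.snd ℝ ℝ (EuclideanSpace ℝ (Fin 3))))))
    {z : ℝ} (hz : |z| < δ) {τ : ℝ} (hτ : |τ| < δ) : AnalyticAt ℝ (fun τ' => R τ' z) τ := by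
  have h := ridgeHeight_analyticAt_curved hUrate hUcont hUmild hUdiv hΓ hν hδh hconc hweb hτ hz
  have hline : AnalyticAt ℝ (fun τ' : ℝ => ((τ', z) : ℝ × ℝ)) τ := analyticAt_id.prod analyticAt_const
  exact h.comp_of_eq hline rfl

end Summit.NavierStokesRegularity.NavierStokesRegularity.Theorems.PoloidalWindowDoorLrcModEntireCurvedRidgeAnalytic

end
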